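import Literature.Geometry.DiscreteGeometry.SphericalPolyhedralData
import HarnessLib

/-!
# The `CBB(1)` certificate in inline (route-statement) form

Topic `Literature/Geometry/DiscreteGeometry`; PROOFS ONLY (no new definitions, no named facts).

The statement items of route `SmoothPoincare4/AngleDefectCertificates`
(`CertifiedSpheresExist`, `PolyhedralPCORecognition`, `PolytopalPCORecognition`,
`CertificateKillsSecondHomology`, `RoundSphereCertificate`) do not mention
`Literature.Geometry.DiscreteGeometry.SphericalPolyhedralData` at all: they quantify over a bare
cosine function `c : V → V → ℝ` (with `V = EuclideanSpace ℝ (Fin N)` and `K.faces` the faces of a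
geometric complex) and spell the certificate out — symmetry, unit diagonal, positive definite
Gram matrices `Matrix.of fun a b : σ => c a b` of the `5`-vertex faces, and for every `3`-vertex
face `t` the bound `∑ᶠ σ ∈ {σ | σ ∈ K.faces ∧ t ⊆ σ ∧ σ.card = 5}, ∑ a : σ, ∑ b : σ,
(if ↑a ∉ t ∧ ↑b ∉ t ∧ a ≠ b then arccos (…) / 2 else 0) ≤ 2π`.

This file records, once and for all, that these clauses ARE
`(SphericalPolyhedralData.mk c symm diag).IsCBBOne K d` — definitionally for general `d`
(`isCBBOne_mk_iff`, proved by `Iff.rfl`), and up to `t.card + 2 = 5 ↔ t.card = 3` in the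
four-dimensional form the route uses (`isCBBOne_mk_four_iff`) — so that provers of those items can
`rw` into the packaged vocabulary and use its API (`dihedralAngleAt_eq_dihedralAngle`,
`coneAngle_eq_sum`, the equicosine closed forms and the `simplexBoundary` calibration).
For a geometric complex `K : Geometry.SimplicialComplex ℝ E` apply the lemmas to
`K.toPreAbstractSimplicialComplex` (`K.faces` is literally its `faces`).

## References

* S. Alexander, V. Kapovitch, A. Petrunin, *An Invitation to Alexandrov Geometry: CAT(0) spaces*
  (2019), §3.4. [AlexanderKapovitchPetrunin2019]
-/

noncomputable section

open Finset Matrix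

namespace Literature.Geometry.DiscreteGeometry

namespace SphericalPolyhedralData

variable {V : Type*} [DecidableEq V]

/-- **Inline form of the certificate, general dimension.** For a bare cosine function `cos`
(symmetric, unit diagonal) the packaged predicate `IsCBBOne` of the datum `⟨cos, symm, diag⟩`
on a complex `K` in dimension `d` is, definitionally, the conjunction of the two spelled-out
clauses: positive definite Gram matrices of the `(d+1)`-vertex faces, and total dihedral angle
`≤ 2π` around every face `t` with `t.card + 2 = d + 1`. [folklore] -/
theorem isCBBOne_mk_iff (K : PreAbstractSimplicialComplex V) (d : ℕ) (cos : V → V → ℝ)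
    (symm : ∀ a b, cos a b = cos b a) (diag : ∀ a, cos a a = 1) :
    (SphericalPolyhedralData.mk cos symm diag).IsCBBOne K d ↔
      (∀ σ ∈ K.faces, σ.card = d + 1 → (Matrix.of fun a b : σ => cos a b).PosDef) ∧
        ∀ t ∈ K.faces, t.card + 2 = d + 1 →
          ∑ᶠ σ ∈ {σ : Finset V | σ ∈ K.faces ∧ t ⊆ σ ∧ σ.card = d + 1},
              (∑ a : σ, ∑ b : σ,
                if (a : V) ∉ t ∧ (b : V) ∉ t ∧ a ≠ b then
                  Real.arccos (-((Matrix.of fun a b : σ => cos a b)⁻¹ a b /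
                    Real.sqrt ((Matrix.of fun a b : σ => cos a b)⁻¹ a a *
                      (Matrix.of fun a b : σ => cos a b)⁻¹ b b))) / 2
                else 0) ≤ 2 * Real.pi :=
  Iff.rfl

/-- **Inline form of the certificate, dimension four** — exactly the clauses of the statement
items of route `SmoothPoincare4/AngleDefectCertificates` (`σ.card = 5`, `t.card = 3`).
[folklore] -/
theorem isCBBOne_mk_four_iff (K : PreAbstractSimplicialComplex V) (cos : V → V → ℝ)
    (symm : ∀ a b, cos a b = cos b a) (diag : ∀ a, cos a a = 1) :
    (SphericalPolyhedralData.mk cos symm diag).IsCBBOne K 4 ↔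
      (∀ σ ∈ K.faces, σ.card = 5 → (Matrix.of fun a b : σ => cos a b).PosDef) ∧
        ∀ t ∈ K.faces, t.card = 3 →
          ∑ᶠ σ ∈ {σ : Finset V | σ ∈ K.faces ∧ t ⊆ σ ∧ σ.card = 5},
              (∑ a : σ, ∑ b : σ,
                if (a : V) ∉ t ∧ (b : V) ∉ t ∧ a ≠ b then
                  Real.arccos (-((Matrix.of fun a b : σ => cos a b)⁻¹ a b /
                    Real.sqrt ((Matrix.of fun a b : σ => cos a b)⁻¹ a a *
                      (Matrix.of fun a b : σ => cos a b)⁻¹ b b))) / 2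
                else 0) ≤ 2 * Real.pi := by
  rw [isCBBOne_mk_iff]
  constructor
  · rintro ⟨h1, h2⟩
    exact ⟨fun σ hσ hc => h1 σ hσ hc, fun t ht hc => h2 t ht (by omega)⟩
  · rintro ⟨h1, h2⟩
    exact ⟨fun σ hσ hc => h1 σ hσ hc, fun t ht hc => h2 t ht (by omega)⟩

omit [DecidableEq V] in
/-- The cosine function of the packaged datum `⟨cos, symm, diag⟩` is `cos` (by `rfl`).
[folklore] -/
theorem cos_mk (cos : V → V → ℝ) (symm : ∀ a b, cos a b = cos b a) (diag : ∀ a, cos a a = 1) :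
    (SphericalPolyhedralData.mk cos symm diag).cos = cos := rfl

omit [DecidableEq V] in
/-- For the packaged datum of a bare cosine function, the Gram matrix of `σ` is literally the
route's `Matrix.of fun a b : σ => c a b`. [folklore] -/
theorem gram_mk (cos : V → V → ℝ) (symm : ∀ a b, cos a b = cos b a) (diag : ∀ a, cos a a = 1)
    (σ : Finset V) :
    (SphericalPolyhedralData.mk cos symm diag).gram σ = Matrix.of fun a b : σ => cos a b := rfl

/-- For the packaged datum of a bare cosine function, the cone angle around `t` in dimension `d`
is literally the route's `finsum` of symmetric double sums. [folklore] -/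
theorem coneAngle_mk (K : PreAbstractSimplicialComplex V) (d : ℕ) (cos : V → V → ℝ)
    (symm : ∀ a b, cos a b = cos b a) (diag : ∀ a, cos a a = 1) (t : Finset V) :
    (SphericalPolyhedralData.mk cos symm diag).coneAngle K d t =
      ∑ᶠ σ ∈ {σ : Finset V | σ ∈ K.faces ∧ t ⊆ σ ∧ σ.card = d + 1},
        ∑ a : σ, ∑ b : σ,
          if (a : V) ∉ t ∧ (b : V) ∉ t ∧ a ≠ b then
            Real.arccos (-((Matrix.of fun a b : σ => cos a b)⁻¹ a b /
              Real.sqrt ((Matrix.of fun a b : σ => cos a b)⁻¹ a a *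
                (Matrix.of fun a b : σ => cos a b)⁻¹ b b))) / 2
          else 0 :=
  rfl

end SphericalPolyhedralData

end Literature.Geometry.DiscreteGeometry
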